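import Summits.QuantumFields.YangMills.Theorems.IR.AfPincerUcXPoly
import Summits.QuantumFields.YangMills.Theorems.BalabanLadderNTSharpTwoPointCeiling
import HarnessLib

/-!
# Crux `IR` (stmt-QuantumFields-19354), slot `af-pincer-Uc`, X-stub `stub_afOnsetUc : AFToOnsetUKPc`: the polynomial-onset regime
# WITHOUT the logarithm — the X-clause holds for onsets up to `(C₀β)^{1/4}`; the stub's open content is `b⋆^c(β)⁴/β` unbounded

Helper (`--supports stmt-QuantumFields-19354`) by the NT fleet lead (`ym-spine-19353-p1`, g28); sequel of
`Theorems/IR/AfPincerUcXPoly` (seat ym-19354-afpincer-s2) with the SHARP volume-uniform two-point ceiling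
`SharpCeilings.exists_abs_Q2_le_sharp` (`|Q2 G r β L s f g| ≤ K/(β²·min(s,1)⁸)`, all odd tori, `β ≥ 4` — NO `(1 + log β)²`; from the
torus doubling of crux `FemtoCurvatureTwoPointC`, `Theorems/BalabanLadderNTSharpTwoPointCeiling`).  Every `(1 + log β)` of the X-side box
of record (`AfOnset.afToOnset_clause_of_polyOnset`, `AfPincerUc.afToOnsetUKPc_clause_of_polyOnset`, `…_of_polyOnset`,
`…_iff_superpoly_regime`) was inherited from the chessboard moments and disappears:

* `afToOnset_clause_of_polyOnset_sharp` — for ANY onset function `b⋆ : ℝ → ℕ` with **`b⋆(β)⁴ ≤ C₀ β`** on a tail (no log), all test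
  functions and every `η > 0`: `∃ T β₁, ∀ β ≥ β₁, ∀ s > 0, T ≤ s·b⋆ β → ∃ᶠ L, |Q2 G r β L s f g| ≤ η` (witness `T = max 1 (K C₀²/η)^{1/8}`…
  here `T⁸ = max 1 (K C₀²/η)`).
* `afToOnsetUKPc_clause_of_polyOnset_sharp`, `afToOnsetUKPc_of_polyOnset_sharp` — the X-clause / the X-stub from `b⋆^c(β)⁴ ≤ C₀ β`.
* **`afToOnsetUKPc_iff_superpoly_regime_sharp`** — `AFToOnsetUKPc` is EQUIVALENT to its restriction to the parameter points where
  **`b⋆^c(β)⁴/β` is unbounded on every tail**: the box of record for the stub loses its logarithm (onsets up to `≍ β^{1/4}` are free; the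
  intended world `b⋆^c ≍ ξ ≍ e^{cβ}` is untouched).

HONEST FRAMING.  Bookkeeping on one open stub of one open gap-crux of a CONDITIONAL chain; nothing of «mixing follows interaction», IR, NT
or the gap.  The Yang–Mills mass gap is NOT proved; not Clay.
-/

set_option autoImplicit false

noncomputable section

open Filter Topology MeasureTheory
open scoped SchwartzMap
open Literature.MathematicalPhysics.QuantumFieldTheory Literature.MathematicalPhysics.QuantumLattice
open Summit.QuantumFields.YangMills.Cruxes.OSLegsFromFemtoAndGap.DlrCollarTransfer (Q2)
open Summit.QuantumFields.YangMills.Cruxes.NT.SharpCeilings (exists_abs_Q2_le_sharp)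

namespace Summit.QuantumFields.YangMills.Cruxes.IR.AfPincerUc

section XPolySharp

variable {G : Type} [Group G] [TopologicalSpace G] [IsTopologicalGroup G] [CompactSpace G]
  [MeasurableSpace G] [BorelSpace G]

/-- **Polynomially growing onsets ⟹ the X-clause, NO logarithm.**  For ANY onset function `b⋆ : ℝ → ℕ` with `b⋆(β)⁴ ≤ C₀ β` on a
tail `[β₀, ∞)`, all test functions `f, g` and every `η > 0` there are `T, β₁` such that `β ≥ β₁`, `s > 0` and `T ≤ s · b⋆ β` force
`|Q2 G r β L s f g| ≤ η` for every `L ≥ 1` (hence frequently).  At `s ≥ 1`: `|Q2| ≤ K/β² ≤ η`; at `s < 1`: `T⁴ ≤ (s b⋆)⁴ ≤ C₀ β s⁴`, so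
`K/(β² s⁸) ≤ K C₀²/T⁸ ≤ η`. [folklore] -/
-- adapted from `AfOnset.afToOnset_clause_of_polyOnset` (`Theorems/BalabanLadderIRAfOnsetLatticeAF`), with the sharp `Q2` ceiling
theorem afToOnset_clause_of_polyOnset_sharp (r : LatticeRep G) (bstar : ℝ → ℕ) {C₀ β₀ : ℝ}
    (hgrowth : ∀ β : ℝ, β₀ ≤ β → ((bstar β : ℕ) : ℝ) ^ 4 ≤ C₀ * β)
    (f g : 𝓢((EuclideanSpace ℝ (Fin 4)), ℝ)) {η : ℝ} (hη : 0 < η) :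
    ∃ T β₁ : ℝ, ∀ β : ℝ, β₁ ≤ β → ∀ s : ℝ, 0 < s → T ≤ s * ((bstar β : ℕ) : ℝ) →
      ∃ᶠ (L : ℕ) in atTop, |Q2 G r β L s f g| ≤ η := by
  obtain ⟨K, hK0, hK⟩ := exists_abs_Q2_le_sharp r f g
  -- `T ≥ 1` with `T⁸ ≥ K C₀² / η`
  set T : ℝ := max 1 (K * C₀ ^ 2 / η) with hTdef
  have hT1 : 1 ≤ T := le_max_left _ _
  have hT0 : 0 < T := lt_of_lt_of_le one_pos hT1
  refine ⟨T, max (max 4 β₀) (Real.sqrt (K / η) + 1), fun β hβ s hs hTs => ?_⟩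
  have hβ4 : 4 ≤ β := le_trans (le_trans (le_max_left _ _) (le_max_left _ _)) hβ
  have hβ₀ : β₀ ≤ β := le_trans (le_trans (le_max_right _ _) (le_max_left _ _)) hβ
  have hβK : Real.sqrt (K / η) + 1 ≤ β := le_trans (le_max_right _ _) hβ
  have hβ0 : 0 < β := by linarith
  -- `K/η < β²`
  have hKβ : K / η < β ^ 2 := by
    have hs0 : 0 ≤ Real.sqrt (K / η) := Real.sqrt_nonneg _
    have hlt : Real.sqrt (K / η) < β := by linarith
    calc K / η = Real.sqrt (K / η) ^ 2 := (Real.sq_sqrt (by positivity)).symm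
      _ < β ^ 2 := pow_lt_pow_left₀ hlt hs0 two_ne_zero
  have key : ∀ L : ℕ, 1 ≤ L → |Q2 G r β L s f g| ≤ η := by
    intro L hL
    refine (hK L hL β hβ4 s hs).trans ?_
    by_cases hs1 : 1 ≤ s
    · rw [min_eq_right hs1, one_pow, mul_one, div_le_iff₀ (pow_pos hβ0 2)]
      have := (div_lt_iff₀ hη).1 hKβ
      linarith
    · have hs1' : s ≤ 1 := (not_le.1 hs1).le
      rw [min_eq_left hs1']
      have hsb0 : 0 ≤ s * ((bstar β : ℕ) : ℝ) := by positivity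
      have h4 : T ^ 4 ≤ (s * ((bstar β : ℕ) : ℝ)) ^ 4 := pow_le_pow_left₀ hT0.le hTs 4
      have hg := hgrowth β hβ₀
      have h5 : T ^ 4 ≤ C₀ * β * s ^ 4 := by
        calc T ^ 4 ≤ (s * ((bstar β : ℕ) : ℝ)) ^ 4 := h4
          _ = s ^ 4 * ((bstar β : ℕ) : ℝ) ^ 4 := by ring
          _ ≤ s ^ 4 * (C₀ * β) := mul_le_mul_of_nonneg_left hg (by positivity)
          _ = C₀ * β * s ^ 4 := by ring
      have h6 : (T ^ 4) ^ 2 ≤ (C₀ * β * s ^ 4) ^ 2 := pow_le_pow_left₀ (by positivity) h5 2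
      have hT8 : K * C₀ ^ 2 / η ≤ T ^ 8 := (le_max_right _ _).trans (le_self_pow₀ hT1 (by norm_num))
      have hTpos : 0 < T ^ 8 := by positivity
      rw [div_le_iff₀ (by positivity)]
      have h7 : K * T ^ 8 ≤ K * (C₀ ^ 2 * β ^ 2 * s ^ 8) := by
        have hre : T ^ 8 = (T ^ 4) ^ 2 := by ring
        calc K * T ^ 8 = K * (T ^ 4) ^ 2 := by rw [hre]
          _ ≤ K * (C₀ * β * s ^ 4) ^ 2 := mul_le_mul_of_nonneg_left h6 hK0
          _ = K * (C₀ ^ 2 * β ^ 2 * s ^ 8) := by ring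
      have h8 : K * C₀ ^ 2 ≤ η * T ^ 8 := by
        have := mul_le_mul_of_nonneg_left hT8 hη.le
        rwa [mul_div_cancel₀ _ (ne_of_gt hη)] at this
      have h9 : K * T ^ 8 ≤ η * (β ^ 2 * s ^ 8) * T ^ 8 := by
        calc K * T ^ 8 ≤ K * (C₀ ^ 2 * β ^ 2 * s ^ 8) := h7
          _ = (K * C₀ ^ 2) * (β ^ 2 * s ^ 8) := by ring
          _ ≤ (η * T ^ 8) * (β ^ 2 * s ^ 8) := mul_le_mul_of_nonneg_right h8 (by positivity)
          _ = η * (β ^ 2 * s ^ 8) * T ^ 8 := by ring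
      exact le_of_mul_le_mul_right h9 hTpos
  exact ((eventually_ge_atTop 1).mono fun L hL => key L hL).frequently

/-- **Polynomially growing typical onset ⟹ the X-clause of `AFToOnsetUKPc` at `(G, r, n, ε, δ)`, NO logarithm**: if
`b⋆^c(β)⁴ ≤ C₀ β` for `β ≥ β₀` then for every pair of test functions and `η > 0` the X-clause holds. [folklore] -/
theorem afToOnsetUKPc_clause_of_polyOnset_sharp (r : LatticeRep G) (n : ℕ) (ε δ : ℝ) {C₀ β₀ : ℝ}
    (hgrowth : ∀ β : ℝ, β₀ ≤ β → ((mixOnsetUc r.ρ β n ε δ : ℕ) : ℝ) ^ 4 ≤ C₀ * β)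
    (f g : 𝓢((EuclideanSpace ℝ (Fin 4)), ℝ)) {η : ℝ} (hη : 0 < η) :
    ∃ T β₁ : ℝ, ∀ β : ℝ, β₁ ≤ β → ∀ s : ℝ, 0 < s → T ≤ s * ((mixOnsetUc r.ρ β n ε δ : ℕ) : ℝ) →
      ∃ᶠ (L : ℕ) in atTop, |Q2 G r β L s f g| ≤ η :=
  afToOnset_clause_of_polyOnset_sharp r (fun β => mixOnsetUc r.ρ β n ε δ) hgrowth f g hη

omit [MeasurableSpace G] [BorelSpace G] in
/-- **The exact price of the X-stub in onset currency, NO logarithm**: if for every `(G, r, n, ε, δ)` (admissible, `δ > 0`) the typical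
onset satisfies `b⋆^c(β)⁴ ≤ C₀ β` on some tail, then `AFToOnsetUKPc` holds (sufficient condition; the intended world has
`b⋆^c ≍ e^{cβ}`). [folklore] -/
theorem afToOnsetUKPc_of_polyOnset_sharp
    (h : ∀ (G : Type) [Group G] [TopologicalSpace G] [IsTopologicalGroup G] [CompactSpace G],
      IsCompactSimpleLieGroup G → letI : MeasurableSpace G := borel G; haveI : BorelSpace G := ⟨rfl⟩;
      ∀ (r : LatticeRep G) (n : ℕ) (ε : ℝ), 1 ≤ n → 0 ≤ ε → ε * OnsetFormats.shellCount n ≤ 3 / 4 →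
        ∀ δ : ℝ, 0 < δ → ∃ C₀ β₀ : ℝ, ∀ β : ℝ, β₀ ≤ β → ((mixOnsetUc r.ρ β n ε δ : ℕ) : ℝ) ^ 4 ≤ C₀ * β) :
    AFToOnsetUKPc := by
  intro G _ _ _ _ hG
  letI : MeasurableSpace G := borel G
  haveI : BorelSpace G := ⟨rfl⟩
  intro r n ε hn hε hM δ hδ v _ η hη
  obtain ⟨C₀, β₀, hgrowth⟩ := h G hG r n ε hn hε hM δ hδ
  exact afToOnsetUKPc_clause_of_polyOnset_sharp r n ε δ hgrowth (thetaTest 4 v) v hη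

omit [MeasurableSpace G] [BorelSpace G] in
/-- **`AFToOnsetUKPc` reduces to the super-`β^{1/4}`-onset regime, NO logarithm**: the registered statement is EQUIVALENT to the same
statement asked only at the parameter points `(G, r, n, ε, δ)` where **`b⋆^c(β)⁴/β` is unbounded on every tail**
(`∀ C₀ β₀, ∃ β ≥ β₀, C₀ β < b⋆^c(β)⁴`); at every other point the X-clause holds by `afToOnsetUKPc_clause_of_polyOnset_sharp`.  This
sharpens `afToOnsetUKPc_iff_superpoly_regime` (the box of record) by the factor `1 + log β`. [folklore] -/
theorem afToOnsetUKPc_iff_superpoly_regime_sharp :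
    AFToOnsetUKPc ↔
    ∀ (G : Type) [Group G] [TopologicalSpace G] [IsTopologicalGroup G] [CompactSpace G],
      IsCompactSimpleLieGroup G → letI : MeasurableSpace G := borel G; haveI : BorelSpace G := ⟨rfl⟩;
      ∀ (r : LatticeRep G) (n : ℕ) (ε : ℝ), 1 ≤ n → 0 ≤ ε → ε * OnsetFormats.shellCount n ≤ 3 / 4 →
        ∀ δ : ℝ, 0 < δ →
        (∀ (C₀ β₀ : ℝ), ∃ β : ℝ, β₀ ≤ β ∧ C₀ * β < ((mixOnsetUc r.ρ β n ε δ : ℕ) : ℝ) ^ 4) →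
        ∀ v : 𝓢(EuclideanSpace ℝ (Fin 4), ℝ), tsupport v ⊆ {y : EuclideanSpace ℝ (Fin 4) | 0 < y 0} →
          ∀ η : ℝ, 0 < η → ∃ T β₁ : ℝ, ∀ β : ℝ, β₁ ≤ β → ∀ s : ℝ, 0 < s →
            T ≤ s * (mixOnsetUc r.ρ β n ε δ : ℝ) →
              ∃ᶠ (L : ℕ) in atTop, |Q2 G r β L s (thetaTest 4 v) v| ≤ η := by
  constructor
  · intro h G _ _ _ _ hG
    letI : MeasurableSpace G := borel G
    haveI : BorelSpace G := ⟨rfl⟩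
    intro r n ε hn hε hM δ hδ _ v hv η hη
    exact h G hG r n ε hn hε hM δ hδ v hv η hη
  · intro h G _ _ _ _ hG
    letI : MeasurableSpace G := borel G
    haveI : BorelSpace G := ⟨rfl⟩
    intro r n ε hn hε hM δ hδ v hv η hη
    by_cases hb : ∃ (C₀ β₀ : ℝ), ∀ β : ℝ, β₀ ≤ β → ((mixOnsetUc r.ρ β n ε δ : ℕ) : ℝ) ^ 4 ≤ C₀ * β
    · obtain ⟨C₀, β₀, hgrowth⟩ := hb
      exact afToOnsetUKPc_clause_of_polyOnset_sharp r n ε δ hgrowth (thetaTest 4 v) v hη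
    · push Not at hb
      exact h G hG r n ε hn hε hM δ hδ hb v hv η hη

end XPolySharp

end Summit.QuantumFields.YangMills.Cruxes.IR.AfPincerUc

end
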